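import Mathlib
import HarnessLib
import Literature.Analysis.FluidPDE.RadialCalculus

/-!
# Route `UnthreadedDoor` / `ThreadingFlux`, crux `PoloidalLiouville` (stmt-NavierStokesRegularity-1222), antidynamo v2 skeleton
# (sha16 `4ebf5683127b`), rung `stub_singleDegreeRung` (BC5): NO HARMONIC RADIAL POWERS — `Δ Q = 0` and `Q = c ‖y‖ˡ` off the origin
# force `c = 0` (`l ≥ 1`)

Support file (seat leafhand-ns-unthreadeddoor-1 g0, cell decomp-ns), `--supports stmt-NavierStokesRegularity-1222 --as helper`; theorems only.
This is the analytic core of the two remaining profile properties asked by step S2 (`…AntidynamoVorticityStructure`) of a non-zero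
solid harmonic `P` of degree `l ≥ 1`: «`Q|_{S²}` is nowhere locally constant» and «`Λ = ∇Q × id ≠ 0` densely» both reduce (by
homogeneity and sphere-connectedness) to `Q = c ‖y‖ˡ` off the origin, which this lemma excludes unless `c = 0`:
`Δ(c ‖y‖ˡ) = c l(l+1) ‖y‖ˡ⁻²` at `y ≠ 0` (tree `Literature.Analysis.FluidPDE.laplacian_comp_norm_sq` with `g(σ) = c σ^{l/2}`).

* ★ `eq_zero_of_laplacian_eq_zero_of_eq_mul_norm_pow` — `Δ Q ≡ 0`, `Q y = c ‖y‖ ^ l` for `y ≠ 0`, `1 ≤ l` ⇒ `c = 0`.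

HONEST LABEL: elementary; nothing here bears on `PoloidalLiouville` (1222) or NS regularity.  [folklore]
-/

noncomputable section

-- the summit and its single sub-problem share the name (CONVENTIONS §1)
set_option linter.dupNamespace false

open scoped Topology InnerProductSpace RealInnerProductSpace ContDiff Laplacian
open Filter Set Function Metric
open Literature.Analysis.FluidPDE

namespace Summit.NavierStokesRegularity.NavierStokesRegularity.Theorems.PoloidalLiouville.Antidynamo

/-- ★ NO HARMONIC RADIAL POWERS.  If `Δ Q ≡ 0` on `ℝ³` and `Q y = c ‖y‖ ^ l` for all `y ≠ 0` with `1 ≤ l`, then `c = 0`: at the unit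
point `e₀` the Laplacian of `c (‖y‖²)^{l/2}` is `c l (l + 1) ≠ 0` unless `c = 0`. [folklore] -/
theorem eq_zero_of_laplacian_eq_zero_of_eq_mul_norm_pow {Q : EuclideanSpace ℝ (Fin 3) → ℝ} {c : ℝ} {l : ℕ} (hl : 1 ≤ l)
    (hharm : ∀ y, (Δ Q) y = 0) (hQ : ∀ y : EuclideanSpace ℝ (Fin 3), y ≠ 0 → Q y = c * ‖y‖ ^ l) : c = 0 := by
  -- the radial profile in the variable `σ = ‖y‖²`
  set p : ℝ := (l : ℝ) / 2 with hp
  set g : ℝ → ℝ := fun σ => c * σ ^ p with hg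
  set g₁ : ℝ → ℝ := fun σ => c * (p * σ ^ (p - 1)) with hg₁
  have hgd : ∀ σ ∈ Ioi (0 : ℝ), HasDerivAt g (g₁ σ) σ := fun σ hσ =>
    (Real.hasDerivAt_rpow_const (Or.inl (ne_of_gt hσ))).const_mul c
  have hg₁d : ∀ σ : ℝ, 0 < σ → HasDerivAt g₁ (c * (p * ((p - 1) * σ ^ (p - 1 - 1)))) σ := fun σ hσ =>
    ((Real.hasDerivAt_rpow_const (Or.inl hσ.ne')).const_mul p).const_mul c
  -- the unit point
  set e₀ : EuclideanSpace ℝ (Fin 3) := EuclideanSpace.single 0 1 with he₀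
  have he₀n : ‖e₀‖ = 1 := by
    rw [he₀, EuclideanSpace.norm_eq]
    simp
  have he₀0 : e₀ ≠ 0 := by rw [← norm_ne_zero_iff, he₀n]; exact one_ne_zero
  -- `Q` agrees with the radial function near `e₀`
  have hloc : Q =ᶠ[𝓝 e₀] fun y => g (‖y‖ ^ 2) := by
    filter_upwards [compl_singleton_mem_nhds he₀0] with y hy
    rw [hQ y hy, hg]
    simp only
    congr 1
    rw [← Real.rpow_natCast ‖y‖ l, ← Real.rpow_natCast ‖y‖ 2, ← Real.rpow_mul (norm_nonneg y)]
    congr 1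
    rw [hp]; push_cast; ring
  have hΔ := hharm e₀
  rw [(InnerProductSpace.laplacian_congr_nhds hloc).eq_of_nhds] at hΔ
  have hσ : ‖e₀‖ ^ 2 ∈ Ioi (0 : ℝ) := by rw [he₀n]; norm_num
  rw [laplacian_comp_norm_sq isOpen_Ioi hgd hσ (hg₁d _ (by rw [he₀n]; norm_num)), finrank_euclideanSpace_fin,
    he₀n] at hΔ
  simp only [one_pow, Real.one_rpow, mul_one, hg₁] at hΔ
  -- `hΔ : 4 c p (p − 1) + 6 c p = 0`, i.e. `c l (l + 1) = 0`
  have hl' : (1 : ℝ) ≤ l := by exact_mod_cast hl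
  have key : c * ((l : ℝ) * (l + 1)) = 0 := by
    rw [hp] at hΔ
    push_cast at hΔ
    nlinarith [hΔ]
  have hne : (l : ℝ) * (l + 1) ≠ 0 := by positivity
  exact (mul_eq_zero.1 key).resolve_right hne

end Summit.NavierStokesRegularity.NavierStokesRegularity.Theorems.PoloidalLiouville.Antidynamo

end
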